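import Summits.Langlands.Langlands.Theses.AbelianSurfaceSerre

/-!
# Route AbelianSurfaceSerre — `SurfaceSectorComplement` (stmt-Langlands-17767): logical position

`SurfaceSectorComplement := EndTrivialSurfacesModular → Langlands` is the route's declared COMPLEMENT
OF THE SECTOR (D-0027 §2.1 convention): the fourth hypothesis of the deciding theorem
`Theses.AbelianSurfaceSerre.closes : SerreGSp4Surjective → QuadraticImprimitiveSurfaces →
BCGPSerreReduction → SurfaceSectorComplement → Langlands`, filed only so that `closes` ends in the
summit constant by name, and declared "never staff it from this route".

This file does NOT assert the item (nor its negation). It records, kernel-checked, exactly where the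
item sits, so that its status `open-problem` is a theorem-shaped fact rather than a remark:

* `abelianSurfaceSerre_surfaceSectorComplement_of_langlands`: `Langlands → SurfaceSectorComplement`;
* `abelianSurfaceSerre_surfaceSectorComplement_of_not_target`: `¬ EndTrivialSurfacesModular →
  SurfaceSectorComplement` (ex falso) — the only other way to prove the frame;
* `abelianSurfaceSerre_surfaceSectorComplement_iff_of_target`: under the route Target, the frame IS
  the summit;
* `abelianSurfaceSerre_surfaceSectorComplement_iff_of_cruxes`: under the two cruxes
  `SerreGSp4Surjective`, `QuadraticImprimitiveSurfaces` and the printed reduction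
  `BCGPSerreReduction` (the other three hypotheses of `closes`), `SurfaceSectorComplement ↔ Langlands`;
* `abelianSurfaceSerre_not_surfaceSectorComplement_iff`: `¬ SurfaceSectorComplement ↔
  EndTrivialSurfacesModular ∧ ¬ Langlands` — a refutation must PROVE the (open) Target (modularity of
  every abelian surface over `ℚ` with `End_ℚ = ℤ`) AND disprove the formal summit;
* `abelianSurfaceSerre_surfaceSectorComplement_iff_not_or`: truth table;
* `abelianSurfaceSerre_target_of_langlands`: the converse bookkeeping — the summit gives the Target
  back MODULO the two standard facts about `r = H¹_ét(A_ℚ̄, ℚ̄_p)` that the summit's direction (B)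
  consumes as hypotheses: irreducibility (Faltings: `End_ℚ(A) = ℤ` ⇒ `V_p A` absolutely irreducible)
  and geometricity (Néron–Ogg–Shafarevich + de Rham at `p` for Fontaine's PINNED datum); hence
  `abelianSurfaceSerre_langlands_iff_target_and_surfaceSectorComplement`: modulo those two facts,
  `Langlands ↔ Target ∧ SurfaceSectorComplement` — the frame is EXACTLY "the summit minus the sector";
* `abelianSurfaceSerre_surfaceSectorComplement_localLanglandsDebt`: frame + Target give a local
  Langlands datum for `GL_n(F_v)` at every finite place of every number field (Harris–Taylor debt).
-/

set_option linter.dupNamespace false -- project-wide option; `Summit.Langlands.Langlands` is the mandated namespace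

namespace Summit.Langlands.Langlands.Theorems

open Summit.Langlands.Langlands.Theses.AbelianSurfaceSerre
open Literature.NumberTheory.GaloisRepresentations Literature.NumberTheory.Automorphic
open IsDedekindDomain

/-- The frame is implied by the summit: `Langlands → SurfaceSectorComplement` (discard the sector
hypothesis). [folklore] -/
theorem abelianSurfaceSerre_surfaceSectorComplement_of_langlands :
    _root_.Langlands → SurfaceSectorComplement :=
  fun h _ ↦ h

/-- The frame is implied, ex falso, by a refutation of the route Target. [folklore] -/
theorem abelianSurfaceSerre_surfaceSectorComplement_of_not_target
    (hX : ¬ EndTrivialSurfacesModular) : SurfaceSectorComplement :=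
  fun h ↦ (hX h).elim

/-- Under the route TARGET `EndTrivialSurfacesModular`, the frame is literally the summit:
`SurfaceSectorComplement ↔ Langlands`. [folklore] -/
theorem abelianSurfaceSerre_surfaceSectorComplement_iff_of_target (hX : EndTrivialSurfacesModular) :
    SurfaceSectorComplement ↔ _root_.Langlands :=
  ⟨fun hC ↦ hC hX, fun h _ ↦ h⟩

/-- Under the other three hypotheses of the deciding theorem — the cruxes `SerreGSp4Surjective`,
`QuadraticImprimitiveSurfaces` and the printed reduction `BCGPSerreReduction` (BCGP 2025 Lemma 10.4.1)
— the frame is equivalent to the summit (`→` is the route's sorry-free `closes`). So this item can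
close only together with the summit once the route's cruxes land. [folklore] -/
theorem abelianSurfaceSerre_surfaceSectorComplement_iff_of_cruxes (h₁ : SerreGSp4Surjective)
    (h₂ : QuadraticImprimitiveSurfaces) (hF : BCGPSerreReduction) :
    SurfaceSectorComplement ↔ _root_.Langlands :=
  -- buildfix 2026-08-20 (proof only; statement byte-identical): the route's `closes` was re-cut to
  -- take `SerreGSp4WreathFixed`/`WreathReductionFixed` in place of `QuadraticImprimitiveSurfaces`;
  -- the `→` direction is the same composition spelled with the items themselves
  -- (`BCGPSerreReduction : SerreGSp4Surjective → QuadraticImprimitiveSurfaces → EndTrivialSurfacesModular`).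
  ⟨fun hC ↦ hC (hF h₁ h₂), fun h _ ↦ h⟩

/-- The exact content of a refutation of the frame:
`¬ SurfaceSectorComplement ↔ EndTrivialSurfacesModular ∧ ¬ Langlands` — prove the open Target AND
disprove the formal summit. [folklore] -/
theorem abelianSurfaceSerre_not_surfaceSectorComplement_iff :
    ¬ SurfaceSectorComplement ↔ EndTrivialSurfacesModular ∧ ¬ _root_.Langlands :=
  Classical.not_imp

/-- Any refutation of the frame is a disproof of the formal summit `_root_.Langlands`. [folklore] -/
theorem abelianSurfaceSerre_not_langlands_of_not_surfaceSectorComplement :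
    ¬ SurfaceSectorComplement → ¬ _root_.Langlands :=
  fun h ↦ (abelianSurfaceSerre_not_surfaceSectorComplement_iff.1 h).2

/-- Truth table of the frame: `SurfaceSectorComplement ↔ ¬ EndTrivialSurfacesModular ∨ Langlands`.
PROVABLE only by proving the summit or by refuting the route Target (a non-modular abelian surface
over `ℚ` with trivial endomorphism ring — a counterexample to the paramodular conjecture), and
REFUTABLE only in the world "Target true, summit false". [folklore] -/
theorem abelianSurfaceSerre_surfaceSectorComplement_iff_not_or :
    SurfaceSectorComplement ↔ ¬ EndTrivialSurfacesModular ∨ _root_.Langlands :=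
  imp_iff_not_or

/-- **The summit gives the Target back, modulo irreducibility and geometricity of `H¹`.** If every
framing `r` of `(V_p A)^∨ ⊗ ℚ̄_p` of an End-trivial abelian surface `A/ℚ` is irreducible (Faltings)
and geometric for Fontaine's pinned datum — unramified at almost all places (Néron–Ogg–Shafarevich) and
de Rham at `v ∣ p` — then direction (B) of `Langlands` at `n = 4`, `F = ℚ`, for the reciprocity data
supplied by the summit's own conjunct `Nonempty (ReciprocityData ℚ)`, yields the Target: the Target's
matching clause is literally the cofinite Satake–Frobenius clause of `Corresponds` (`m = 1`,
L-algebraic, arithmetic Frobenius). The two hypotheses are stated `𝓡`-free (`ReciprocityData.pst` IS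
the pinned datum). [folklore] -/
theorem abelianSurfaceSerre_target_of_langlands (hL : _root_.Langlands)
    (hH : ∀ (A : Literature.AlgebraicGeometry.Motives.AbelianVariety ℚ), A.dim = 2 →
      (∀ f : A ⟶ A, ∃ n : ℤ, f = n • CategoryTheory.CategoryStruct.id A) →
      ∀ (p : ℕ) [Fact p.Prime] (b : Module.Basis (Fin 4) ℚ_[p] (A.rationalTateModule p))
        (r : FramedGaloisRep ℚ (PadicAlgCl p) 4),
        (∀ g : Field.absoluteGaloisGroup ℚ, (r g).val =
          ((LinearMap.toMatrix b b (A.rationalTateRep p g⁻¹)).map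
            (algebraMap ℚ_[p] (PadicAlgCl p))).transpose) →
        r.toGaloisRep.IsIrreducible ∧
          (∀ᶠ v : HeightOneSpectrum (NumberField.RingOfIntegers ℚ) in Filter.cofinite,
            r.IsUnramifiedAt v) ∧
          ∀ (v : HeightOneSpectrum (NumberField.RingOfIntegers ℚ))
            (hv : ((p : ℕ) : NumberField.RingOfIntegers ℚ) ∈ v.asIdeal),
            (Literature.NumberTheory.PAdicHodge.fontainePstAdicCompletion v p hv).IsDeRhamFramed
              (r.toLocal v)) :
    EndTrivialSurfacesModular := by
  intro A hA hEnd p _ b r hr hcpt ι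
  obtain ⟨⟨𝓡⟩, h⟩ := hL ℚ
  have hB : Summit.Langlands.GaloisToAutomorphic 4 𝓡 hcpt := (h 𝓡 4 (by norm_num) hcpt).2
  obtain ⟨hirr, hur, hdR⟩ := hH A hA hEnd p b r hr
  obtain ⟨π, hLalg, hcorr⟩ := hB p ι r hirr ⟨hur, hdR⟩
  exact ⟨π, hLalg, hcorr.1⟩

/-- **Modulo irreducibility and geometricity of `H¹` of End-trivial abelian surfaces,
`Langlands ↔ Target ∧ SurfaceSectorComplement`**: the frame is exactly "the summit minus the
sector", no more and no less. [folklore] -/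
theorem abelianSurfaceSerre_langlands_iff_target_and_surfaceSectorComplement
    (hH : ∀ (A : Literature.AlgebraicGeometry.Motives.AbelianVariety ℚ), A.dim = 2 →
      (∀ f : A ⟶ A, ∃ n : ℤ, f = n • CategoryTheory.CategoryStruct.id A) →
      ∀ (p : ℕ) [Fact p.Prime] (b : Module.Basis (Fin 4) ℚ_[p] (A.rationalTateModule p))
        (r : FramedGaloisRep ℚ (PadicAlgCl p) 4),
        (∀ g : Field.absoluteGaloisGroup ℚ, (r g).val =
          ((LinearMap.toMatrix b b (A.rationalTateRep p g⁻¹)).map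
            (algebraMap ℚ_[p] (PadicAlgCl p))).transpose) →
        r.toGaloisRep.IsIrreducible ∧
          (∀ᶠ v : HeightOneSpectrum (NumberField.RingOfIntegers ℚ) in Filter.cofinite,
            r.IsUnramifiedAt v) ∧
          ∀ (v : HeightOneSpectrum (NumberField.RingOfIntegers ℚ))
            (hv : ((p : ℕ) : NumberField.RingOfIntegers ℚ) ∈ v.asIdeal),
            (Literature.NumberTheory.PAdicHodge.fontainePstAdicCompletion v p hv).IsDeRhamFramed
              (r.toLocal v)) :
    _root_.Langlands ↔ EndTrivialSurfacesModular ∧ SurfaceSectorComplement :=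
  ⟨fun hL ↦ ⟨abelianSurfaceSerre_target_of_langlands hL hH, fun _ ↦ hL⟩, fun h ↦ h.2 h.1⟩

/-- The frame carries the summit's shared Statement debt: together with the route Target it yields,
for EVERY number field `F` and EVERY finite place `v`, a local Langlands datum for the general linear
groups over `F_v` (the `llc` field of the reciprocity data that `Langlands` asserts to exist) —
Harris–Taylor/Henniart content, far outside the abelian-surface sector. [folklore] -/
theorem abelianSurfaceSerre_surfaceSectorComplement_localLanglandsDebt (hC : SurfaceSectorComplement)
    (hX : EndTrivialSurfacesModular) (F : Type) [Field F] [NumberField F]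
    (v : HeightOneSpectrum (NumberField.RingOfIntegers F)) :
    Nonempty (LocalLanglandsDatum (v.adicCompletion F)) := by
  obtain ⟨⟨𝓡⟩, -⟩ := hC hX F
  exact ⟨𝓡.llc v⟩

end Summit.Langlands.Langlands.Theorems
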